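import Summits.AnomalousDissipation.AnomalousDissipation.Theorems.SolenoidalFractalHomogenisationLagrangianStepCellSlowLeakage
import HarnessLib

/-!
# K1L_D — the registered stub `stub_cellEnergyT` (v2 text) CLOSED: the cell-energy clauses (F_T) + (C)

Crux `LagrangianRenormalisationStepDesign` (route `SolenoidalFractalHomogenisation`, item `stmt-AnomalousDissipation-27980`; banked K1L∀
item `stmt-AnomalousDissipation-24912`), line «onelevel-design», registry v2 (sha16 252defa867070e3f).  The registered text of
`stub_cellEnergyT` — for every design word, pre-stretch `M > 0`, gain `c > 0` and window `(lo, hi, Λ, β)` with `0 < lo ≤ 1 ≤ hi`, `1 < Λ`,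
`0 ≤ β` there are `C ≥ 0`, `ν₀, K > 0` with `CellEnergyClausesWNoE W M hM c lo hi Λ β C ν₀ K` — is `cellEnergyT_W`
(`…LagrangianStepCellSlowLeakage`, p639427): clause (F_T) by the primal energy route (grid-character projection onto the sectors of the slow
block + two-scale Grönwall, `cell_slow_leakage`) and clause (C) by the damped fast block (`cell_corrector_content`, p634914), with
`ν₀ = 1`, `K = 3`, `C = 9k²Λ²/(π⁴lo²c) + 144k²Λ²/(π⁴lo²c) + 36k²Λ/(π²lo)`.  Not the crux; says nothing about anomalous dissipation.
Prover seat `lead-k1l-onelevel-p1` g0.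
-/

set_option linter.dupNamespace false

noncomputable section

namespace Summit.AnomalousDissipation.AnomalousDissipation.Theorems.SolenoidalFractalHomogenisation.LagrangianStep

open Literature.Analysis Literature.Analysis.FluidPDE Literature.Analysis.FunctionSpaces
open Literature.Analysis.FluidPDE.LatticeShear

/-- **`stub_cellEnergyT` (K1L_D registry v2, text verbatim): the cell-energy clauses (F_T) + (C) of the tensor cell package hold** for every
design word `W`, pre-stretch `M > 0`, bookkept gain `c > 0` and window `(lo, hi, Λ, β)` (`0 < lo ≤ 1 ≤ hi`, `1 < Λ`, `0 ≤ β`), with explicit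
constants (`cellEnergyT_W`). -/
theorem stub_cellEnergyT : ∀ k (W : Literature.Analysis.FluidPDE.LatticeShear.LatticeWord k) (M : ℝ) (hM : 0 < M) (c : ℝ), 0 < c →
    ∀ lo hi Λ β : ℝ, 0 < lo → lo ≤ 1 → 1 ≤ hi → 1 < Λ → 0 ≤ β →
      ∃ C : ℝ, 0 ≤ C ∧ ∃ ν₀ > (0:ℝ), ∃ K > (0:ℝ), CellEnergyClausesWNoE W M hM c lo hi Λ β C ν₀ K :=
  cellEnergyT_W

end Summit.AnomalousDissipation.AnomalousDissipation.Theorems.SolenoidalFractalHomogenisation.LagrangianStep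

end
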